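import Summits.BirchSwinnertonDyer.BirchSwinnertonDyer.Theorems.ByReductionTypeAtTwoOrdKatoHalfAtTwoIsoOptimalOff514Defs
import Summits.BirchSwinnertonDyer.BirchSwinnertonDyer.Theses.ByReductionTypeAtTwo
import HarnessLib

/-!
# Crux `OrdKatoHalfAtTwoIso` (stmt-BirchSwinnertonDyer-19573), line `steinberg-fibre-at-two` — RESTATE CERTIFICATE for
# child stmt-BirchSwinnertonDyer-23780 `OrdKatoMuPartOptimalAtTwo` (B7; lead g4, after p679274)

Nothing asserted; `sorry`-free. (1) `restated23780_text_iff`: the proposed re-typed text of child 23780 (B7 re-cut off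
Greenberg's Prop. 5.14 locus; route-file vocabulary, fully qualified, `X5.O1.KatoMuPartAtTwo` leaf named as at rev 28) is
`Iff.rfl` the Theorems constant `SteinbergFibreAtTwo.KatoMuPartOff514AtOptimalMemberOfNotSurjectiveTwo` (p679274).
(2) `filed_implies_restated`: the filed text implies the new one (kernel, `katoMuPartOff514_of_katoMuPartAtOptimalMember`).
(3) `ordKatoHalfAtTwoIsoOfChildren_recut_text`: with BOTH children re-typed (23760 ↦ `ZetaColemanMuInputsNegDiscAtTwo` — its
route text is `Iff.rfl` that constant by `Lines/steinberg_fibre_at_two_restate_23760.lean` — and 23780 ↦ this text) and the print bundle enlarged by Greenberg's Prop. 5.14 at `2` (`prop514_isTorsion_mu_eq_zero_two`,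
PRINT, by name), the split glue closes BY NAME by `SteinbergFibreAtTwo.ordKatoHalfAtTwoIso_of_recut_cite`.
BSD is not proved; the crux and its children stay OPEN.
-/

set_option linter.dupNamespace false

namespace Summit.BirchSwinnertonDyer.BirchSwinnertonDyer.Cruxes.OrdKatoHalfAtTwoIso.SteinbergFibreAtTwo.Restate23780

open Summit.BirchSwinnertonDyer.BirchSwinnertonDyer.Theses.ByReductionTypeAtTwo
open Summit.BirchSwinnertonDyer.BirchSwinnertonDyer.Theorems

/-- PROPOSED TEXT of child 23780 (B7 re-cut off the Prop. 5.14 locus; route vocabulary, fully qualified). [folklore] -/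
def OrdKatoMuPartOptimalAtTwoRestatedText : Prop :=
  ∀ (W : WeierstrassCurve ℚ) [W.IsElliptic] [W.IsGloballyMinimal], ¬ W.HasCM → Literature.NumberTheory.EllipticCurves.Rank1Residual.GoodOrd W 2 → ¬ W.HasSurjectiveModNGaloisRep 2 → ∃ (W' : WeierstrassCurve ℚ) (_ : W'.IsElliptic) (_ : W'.IsGloballyMinimal), WeierstrassCurve.IsIsogenous W W' ∧ (Summit.BirchSwinnertonDyer.Rank1Residual.X5.O1.KatoMuPartAtTwo W' ∨ ∃ x y : ℚ, W'.toAffine.Equation x y ∧ 2 * y + W'.a₁ * x + W'.a₃ = 0 ∧ ((Literature.NumberTheory.EllipticCurves.Greenberg1999.TwoTorsionRamifiedAtTwo x ∧ ¬ Literature.NumberTheory.EllipticCurves.Greenberg1999.TwoTorsionOdd W' x) ∨ (Literature.NumberTheory.EllipticCurves.Greenberg1999.TwoTorsionOdd W' x ∧ ¬ Literature.NumberTheory.EllipticCurves.Greenberg1999.TwoTorsionRamifiedAtTwo x))) ∧ ∀ [NeZero (W'.conductorNorm ℤ)] (f : CuspForm (CongruenceSubgroup.Gamma0 (W'.conductorNorm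 ℤ)) 2), Literature.NumberTheory.EllipticCurves.ModularForms.IsNewformOf W' f → ∀ ϖ : ℚ, (ϖ : ℝ) * W'.realPeriodRat = Literature.NumberTheory.EllipticCurves.ModularForms.plusPeriod f → ∃ L₀ : Literature.NumberTheory.EllipticCurves.IwasawaAlgebra 2, Literature.NumberTheory.EllipticCurves.iwasawaToPowerSeries 2 L₀ = PowerSeries.C (ϖ : ℚ_[2]) * Literature.NumberTheory.EllipticCurves.padicLFunction f (Literature.NumberTheory.EllipticCurves.unitRoot W' 2 : ℚ_[2])

/-- (1) The proposed text is VERBATIM (`Iff.rfl`) the Theorems constant. [folklore] -/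
theorem restated23780_text_iff :
    OrdKatoMuPartOptimalAtTwoRestatedText ↔ SteinbergFibreAtTwo.KatoMuPartOff514AtOptimalMemberOfNotSurjectiveTwo :=
  Iff.rfl

/-- (2) The filed child text (rev 28) implies the proposed one. [folklore] -/
theorem filed_implies_restated (h : OrdKatoMuPartOptimalAtTwo) : OrdKatoMuPartOptimalAtTwoRestatedText :=
  SteinbergFibreAtTwo.katoMuPartOff514_of_katoMuPartAtOptimalMember h

/-- (3) The split glue with both children re-typed and the print bundle `PUB ∧ AU ∧ Prop 5.14@2` closes by name. [folklore] -/
theorem ordKatoHalfAtTwoIsoOfChildren_recut_text :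
    (Literature.Uncategorized.OrdPublishedInputsAtTwo ∧
      Literature.NumberTheory.EllipticCurves.ModularForms.abbesUllmo_not_dvd_maninConstant_of_not_dvd_level ∧
      Literature.NumberTheory.EllipticCurves.Greenberg1999.prop514_isTorsion_mu_eq_zero_two) →
    SteinbergFibreAtTwo.ZetaColemanMuInputsNegDiscAtTwo → OrdKatoMuPartOptimalAtTwoRestatedText →
      OrdKatoIntSurjectiveAtTwo → OrdKatoHalfAtTwoIso :=
  fun hB hF1 hB7 hB8 => SteinbergFibreAtTwo.ordKatoHalfAtTwoIso_of_recut_cite hF1 hB.2.1 hB.2.2 hB7 hB8 hB.1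

end Summit.BirchSwinnertonDyer.BirchSwinnertonDyer.Cruxes.OrdKatoHalfAtTwoIso.SteinbergFibreAtTwo.Restate23780
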